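import Literature.NumberTheory.LFunctions.ClassGroupLogFreeLemmaB
import Literature.NumberTheory.LFunctions.LogFreeLemmaBAbstractLargeSlack
import HarnessLib

/-!
# Bombieri's Lemme B for the class group `L`-functions of a number field — every degree

Topic `Literature/NumberTheory/LFunctions`, namespace `Literature.NumberTheory.LFunctions.NumberField`.
Everything here is PROVED (theorems only; no definitions, no named facts).

The tree's `lemmeB_classGroup` (`ClassGroupLogFreeLemmaB.lean`) is Bombieri's Lemme B for `L₀(s, χ)`,
`χ ∈ Ĉl_K ∖ {1}`, for number fields of degree `n_K ≤ 4` only: Lemme A on the series side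
(`exists_norm_tsum_gTermB_ge_classGroup`) has slack `η = n_K`, and the abstract Lemme B of the tree takes
`η ≤ 4`.  With the large-slack abstract Lemme B (`LogFreeDensity.lemmeB_core_abstract_of_le`, slack
`η ≤ K = ⌊r log x/240⌋`) the same argument works in EVERY degree, the constant `A₀` (the factor in
`log x ≥ A₀ ℒ'`) now growing linearly with the degree bound `n` so that `K ≥ n ≥ n_K`:

* `lemmeB_classGroup_of_le (n)` — **Lemme B for `L₀(s, χ)`, `χ ≠ 1`, `n_K ≤ n`**: there are `A₀, r₀ > 0`
  (depending on `n` only) such that for `ℒ'_v ≤ L'`, `0 < r ≤ r₀`, `rL' ≥ 1`, `L₀ ≠ 0` on `Re s ≥ 1`, a zero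
  of `L₀(·, χ)` within `r` of `1 + iv`, `log x ≥ A₀ L'`, `z ≤ x^{a₀/2}`:
  `e^{−10}/n² · x^{−r/10}/r³ ≤ ∫_{⌊x^{a₀}⌋}^{x} ‖Σ_{⌊x^{a₀}⌋ < m ≤ t, m = p^j, p > z} b_m‖² dt/t`.

This is the `χ ≠ 1` input of the log-free zero-density estimate for `Ĉl_K` in every degree (Weiss 1983
Thm. 4.3 / Thorner–Zaman 2019 Thm. 3.2 without the Deuring–Heilbronn factor, `H = P_K`).

## References

* [Bombieri1987GrandCrible] E. Bombieri, Astérisque 18 (1987), §6 Lemme B, pp. 46–48.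
* [ThornerZaman2017] J. Thorner, A. Zaman, Algebra Number Theory 11 (2017), §5.
* [ThornerZaman2019] J. Thorner, A. Zaman, Algebra Number Theory 13 (2019) 1039–1068, Thm. 3.2.
* [Weiss1983] A. Weiss, J. reine angew. Math. 338 (1983) 56–94, Thm. 4.3.
-/

noncomputable section

open Complex Metric Set Filter Finset
open scoped Real Topology LSeries.notation ArithmeticFunction.vonMangoldt

namespace Literature.NumberTheory.LFunctions.NumberField

open Literature.NumberTheory.LFunctions.LogFreeLocal Literature.NumberTheory.LFunctions.LogFreeDensity
open scoped nonZeroDivisors _root_.NumberField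

/-- **Bombieri's Lemme B for `L₀(s, χ)`, `χ ≠ 1`, in every degree** (uniformly over the number fields of
degree `≤ n`): there are `A₀, r₀ > 0` depending only on `n` such that for `n_K ≤ n`, `ℒ'_v ≤ L'`,
`0 < r ≤ r₀`, `rL' ≥ 1`, `L₀ ≠ 0` on `Re s ≥ 1`, a zero `ρ₀` of `L₀(·, χ)` with `|ρ₀ − (1 + iv)| ≤ r`,
`0 < x`, `log x ≥ A₀ L'` and `z ≤ x^{a₀/2}`,
`e^{−10}/n² · x^{−r/10}/r³ ≤ ∫_{⌊x^{a₀}⌋}^{x} ‖Σ_{⌊x^{a₀}⌋ < m ≤ t, m = p^j, p > z} b_m‖² dt/t`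
(slack `η = n_K ≤ n ≤ K` in `lemmeB_core_abstract_of_le`, and `n_K² ≤ n²`).
[cite: Bombieri1987GrandCrible, §6 Lemme B] -/
theorem lemmeB_classGroup_of_le (n : ℕ) :
    ∃ A₀ r₀ : ℝ, 0 < A₀ ∧ 0 < r₀ ∧
      ∀ (K : Type*) [Field K] [NumberField K] (χ : ClassGroup (𝓞 K) →* ℂˣ), χ ≠ 1 →
      Module.finrank ℚ K ≤ n →
      (∀ ρ : ℂ, classGroupLFunction₀ K χ ρ = 0 → ρ.re < 1) →
      ∀ (v r L' x : ℝ) (z : ℕ), lemmaAHeight K v ≤ L' → 0 < r → r ≤ r₀ → 1 ≤ r * L' →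
        (∃ ρ₀ : ℂ, classGroupLFunction₀ K χ ρ₀ = 0 ∧ ‖ρ₀ - (1 + (v : ℂ) * I)‖ ≤ r) →
        0 < x → A₀ * L' ≤ Real.log x → (z : ℝ) ≤ x ^ (expoB / 2) →
          Real.exp (-10) / (n : ℝ) ^ 2 * x ^ (-(r / 10)) / r ^ 3 ≤
            ∫ t in Set.Ioc (⌊x ^ expoB⌋₊ : ℝ) x, ‖summatory (coefSiftedB (coefB K χ v) x z) t‖ ^ 2 / t := by
  obtain ⟨c₄, hc₄, hA⟩ := exists_norm_tsum_gTermB_ge_classGroup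
  set θ : ℝ := Real.exp 14 with hθ
  have hθ1 : 1 ≤ θ := Real.one_le_exp (by norm_num)
  have hn0 : (0 : ℝ) ≤ n := Nat.cast_nonneg n
  refine ⟨240 * (c₄ + 8 * θ + 8 + n), 1 / (112 * θ), by positivity, by positivity,
    fun K _ _ χ hχ hnK hline v r L' x z hL hr hr0 hu hzero hx hlogx hz => ?_⟩
  have hL'1 : 1 ≤ L' := (one_le_lemmaAHeight v).trans hL
  set u : ℝ := r * L' with hudef
  have hr1 : r ≤ 1 := by
    have : 1 / (112 * θ) ≤ 1 := by rw [div_le_one (by positivity)]; nlinarith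
    linarith
  have hr8 : 512 * r ≤ 1 / 8 := by
    have h := hr0
    rw [le_div_iff₀ (by positivity)] at h
    have h14 : (4096 : ℝ) ≤ θ := by
      have := pow_le_exp_mul (c := 4096) (m := 14) (by norm_num) (by norm_num) 1
      simpa [hθ] using this
    nlinarith
  set Lx : ℝ := Real.log x with hLx
  have hA₀pos : 0 < 240 * (c₄ + 8 * θ + 8 + n) := by positivity
  have hLxpos : 0 < Lx := lt_of_lt_of_le (by positivity) hlogx
  have hrLx : 240 * (c₄ + 8 * θ + 8 + n) * u ≤ r * Lx := by
    rw [hudef]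
    have := mul_le_mul_of_nonneg_left hlogx hr.le
    linarith
  set K' : ℕ := ⌊r * Lx / 240⌋₊ with hKdef
  have hK1 : (K' : ℝ) ≤ r * Lx / 240 := Nat.floor_le (by positivity)
  have hKlow : (c₄ + 8 * θ + 8 + n) * u - 1 ≤ K' := by
    have hK2 : r * Lx / 240 < K' + 1 := Nat.lt_floor_add_one _
    have : (c₄ + 8 * θ + 8 + n) * u ≤ r * Lx / 240 := by
      rw [le_div_iff₀ (by norm_num)]; linarith
    linarith
  have hu1 : (1 : ℝ) ≤ u := hu
  have hprod1 : 0 ≤ (8 * θ + 8 + n) * (u - 1) := mul_nonneg (by positivity) (by linarith only [hu1])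
  have hprod2 : 0 ≤ c₄ * u := mul_nonneg hc₄.le (by linarith only [hu1])
  have hprod3 : 0 ≤ (n : ℝ) * u := mul_nonneg hn0 (by linarith only [hu1])
  have hKc : c₄ * (r * L') + 2 ≤ K' := by
    rw [← hudef]
    nlinarith only [hKlow, hprod1, hθ1, hu1, hn0]
  have hK8r : (8 : ℝ) ≤ K' := by
    nlinarith only [hKlow, hprod1, hprod2, hθ1, hu1, hn0]
  have hK8 : 8 ≤ K' := by exact_mod_cast hK8r
  have hKθ : 8 * θ * u ≤ K' := by
    nlinarith only [hKlow, hprod2, hu1, hn0, hprod3]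
  have hnK' : (n : ℝ) ≤ K' := by
    nlinarith only [hKlow, hprod1, hprod2, hθ1, hu1, hn0, hprod3]
  -- Lemme A on the series side, slack `η = n_K ≤ n ≤ K'`
  obtain ⟨k, hk, hmain⟩ := hA K χ hχ hline v r L' hL hr hr8 hu hzero K' hKc
  have hη1 : (1 : ℝ) ≤ Module.finrank ℚ K := by exact_mod_cast Module.finrank_pos (R := ℚ) (M := K)
  have hηn : (Module.finrank ℚ K : ℝ) ≤ n := by exact_mod_cast hnK
  have hηK : (Module.finrank ℚ K : ℝ) ≤ K' := hηn.trans hnK'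
  have h := lemmeB_core_abstract_of_le (norm_coefB_le χ v) (fun m hm ↦ coefB_eq_zero_of_not_isPrimePow χ v hm)
    hr hr0 hu hx hη1 hηK hK8 hKθ hk (summable_gTermB_coefB χ v hr k) hmain hz
  refine le_trans ?_ h
  -- `e^{-10}/n² ≤ e^{-10}/n_K²`
  have hsq : (Module.finrank ℚ K : ℝ) ^ 2 ≤ (n : ℝ) ^ 2 := pow_le_pow_left₀ (by positivity) hηn 2
  have hsqpos : 0 < (Module.finrank ℚ K : ℝ) ^ 2 := by positivity
  have hxr : 0 ≤ x ^ (-(r / 10)) / r ^ 3 := by positivity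
  have h1 : Real.exp (-10) / (n : ℝ) ^ 2 ≤ Real.exp (-10) / (Module.finrank ℚ K : ℝ) ^ 2 :=
    div_le_div_of_nonneg_left (Real.exp_pos _).le hsqpos hsq
  calc Real.exp (-10) / (n : ℝ) ^ 2 * x ^ (-(r / 10)) / r ^ 3
      = Real.exp (-10) / (n : ℝ) ^ 2 * (x ^ (-(r / 10)) / r ^ 3) := by ring
    _ ≤ Real.exp (-10) / (Module.finrank ℚ K : ℝ) ^ 2 * (x ^ (-(r / 10)) / r ^ 3) :=
        mul_le_mul_of_nonneg_right h1 hxr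
    _ = _ := by ring

end Literature.NumberTheory.LFunctions.NumberField

end
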